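/-
Copyright: the b2b-balaban T⁴-continuum CRUX team, row NE7b OWNER lineage `t4-ne7b-p1` (gen 127). Project licence.
-/
import Summits.QuantumFields.BalabanUV.T4Continuum.Spine.NE7b.SupFibreGaussianIBP

/-!
# GAUSSIAN INTEGRATION BY PARTS ON THE FIBRE, II — INTEGRABLE OBSERVABLES AND THE TILTED MEASURE: (272)'s identity
# `∫ ⟨f,Pz⟩G(Pz)ρ = ∫ DG(Pz)(Cf)ρ` (`ρ = e^{−½H(Pz)(Pz)}`, `C = PM_z⁻¹Pᵀ` the fluctuation covariance) for every DIFFERENTIABLE `G` under the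
# three integrability conditions (so polynomial × exponential observables are admitted, not only bounded `C¹` ones), and its TILTED form
# (Glimm–Jaffe (9.1.32)): for an interaction `W`, `∫ ⟨f,Pz⟩G(Pz)e^{−W(Pz)}ρ = ∫ (DG(Pz)(Cf) − G(Pz)·DW(Pz)(Cf))e^{−W(Pz)}ρ` — the identity every
# Mayer ∕ decoupling step of the road's interacting fluctuation integral differentiates (row NE7b, node U5c; (271)∕(272) + the tree's
# `B14.Eq328GaussianIBP.integral_dotProduct_mul_mul_gaussDensity_of_integrable` BY NAME; [folklore])

Cell `pub-balaban`, sub-cell `t4`, spine estimate NE7b (`T4WeightBudget.RelWeightBound`; the cell's OWN estimate — NOT PRINTED in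
[Bałaban 1983–89], NOT PROVED).  Crux-route work under `Spine/NE7b/` by the row OWNER (`t4-ne7b-p1` gen 127, file (277)) under FREEZE
(0)'s crux-prover clause, on § [NE7bP1-G126-HANDOFF] NEXT (3)(d), at TEA's level; NOTHING of Bałaban's is named as a Lean object, valued
or asserted; no `T4Continuum/Support` leaf typed; no `def`, no notation; zero `sorry`.  Imports (BY NAME): the OWNER's (272)
`…SupFibreGaussianIBP` (`pairing_eq_dotProduct`, `fderiv_comp_chart`; through it (271) `form_chart_eq`, `chart_posDef`,
`covariance_mem_fibre`); the tree's `B14.Eq328GaussianIBP.integral_dotProduct_mul_mul_gaussDensity_of_integrable` ([GlimmJaffe1987]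
(9.1.28) in finite dimensions, integrable form, 0 sorry); Mathlib's `HasFDerivAt.mul`, `HasFDerivAt.exp`.

WHY (located).  (272) admits bounded `C¹` observables; the road's observables are products of fields and exponentials of the interaction
`W` (the non-quadratic remainder of the action on the fibre), whose derivative grows linearly (`−λ ≤ v″ ≤ Λ`), so the usable form is the
integrable one, with the Gaussian envelope discharging integrability downstream ((114)∕(121)'s `integrable_gaussian_pi` pattern).  The
tilted identity is the same identity for the observable `G·e^{−W}` and the product rule — written once here so that no later file redoes
the calculus.

WHAT IS PROVED ([folklore]; `ι`, `σ` finite, `H` symmetric with floor, chart bound, `M_z(j,k) = H(Pe_j)(Pe_k)`, `C = PM_z⁻¹Pᵀ` displayed):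
* §1 **`fibre_gaussian_ibp_of_integrable`** (`G` differentiable everywhere; integrable `⟨f,Pz⟩G(Pz)ρ`, `DG(Pz)(Cf)ρ`, `G(Pz)ρ` ⟹ the identity).
* §2 `fderiv_mul_exp_neg_apply` (`D(G·e^{−W})(φ)v = (DG(φ)v − G(φ)DW(φ)v)e^{−W(φ)}`), THE END **`fibre_gaussian_ibp_tilted`** (`G, W`
  differentiable; the three integrability conditions for the tilted integrands ⟹
  `∫ ⟨f,Pz⟩G(Pz)e^{−W(Pz)}ρ = ∫ (DG(Pz)(Cf) − G(Pz)DW(Pz)(Cf))e^{−W(Pz)}ρ`); §3 toy.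

HONEST (what this is NOT).  Calculus by name; integrability is HYPOTHESIS (the Gaussian envelope that discharges it for the road's class is
not restated); no normalisation by the tilted partition function (divide both sides); nothing of cluster expansions themselves; scalar
skeleton ((A3), NC-NE7b-α UNRULED); nothing of Bałaban's asserted.  BY-NAME EFFECT ON THE WALL: NONE.  NE7b NOT PRINTED ∕ NOT PROVED; spine
PROVED 0∕9; rung (B)+1 — the programme's measures remain FINITE-torus statements; NOT the mass gap, NOT Clay.  HONEST DEPENDENCY: continuum
YM on T⁴ ⇐ BetaPertH ∧ nine spine estimates (0∕9 proved); BetaPertH ⇐ (D1) ∧ (D4) ∧ CAP+tail; G-an2-4 gates asym, D1 and NE2∕3∕4.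
-/

set_option autoImplicit false

noncomputable section

namespace Summit.QuantumFields.BalabanUV.T4Continuum.NE7b.SupFibreGaussianIBPTilted

open MeasureTheory Real Matrix
open Literature.MathematicalPhysics.QuantumFieldTheory.Balaban1983to89
open B14.Eq328GaussianIBP (integral_dotProduct_mul_mul_gaussDensity_of_integrable)
open SupFibreGaussianCovariance (form_chart_eq chart_posDef covariance_mem_fibre)
open SupFibreGaussianIBP (pairing_eq_dotProduct fderiv_comp_chart)

variable {ι : Type*} [Fintype ι] {σ : Type} [Fintype σ] [DecidableEq σ]
  {H : (ι → ℝ) →L[ℝ] (ι → ℝ) →L[ℝ] ℝ} {m p : ℝ} (P : (σ → ℝ) →L[ℝ] (ι → ℝ))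

/-! ## §1. The identity for integrable observables -/

/-- **GAUSSIAN IBP ON THE FIBRE, INTEGRABLE FORM**: `H` symmetric with floor `m > 0`, chart bound `p > 0`, `M_z(j,k) = H(Pe_j)(Pe_k)`, `G`
differentiable everywhere, and the three products integrable ⟹
`∫ ⟨f,Pz⟩G(Pz)e^{−½H(Pz)(Pz)}dz = ∫ DG(Pz)(PM_z⁻¹Pᵀf)e^{−½H(Pz)(Pz)}dz`. [folklore] -/
theorem fibre_gaussian_ibp_of_integrable (hHsym : ∀ h k : ι → ℝ, H h k = H k h)
    (hfl : ∀ h : ι → ℝ, m * ∑ x, h x ^ 2 ≤ H h h) (hm : 0 < m) (hP : ∀ z : σ → ℝ, p * ∑ i, z i ^ 2 ≤ ∑ x, P z x ^ 2) (hp : 0 < p)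
    (Mz : Matrix σ σ ℝ) (hMz : ∀ j k, Mz j k = H (P (Pi.single j 1)) (P (Pi.single k 1))) {G : (ι → ℝ) → ℝ}
    (hG : ∀ v, DifferentiableAt ℝ G v) (f : ι → ℝ)
    (h1 : Integrable fun z : σ → ℝ => (∑ x, f x * P z x) * G (P z) * exp (-((1 / 2 : ℝ) * H (P z) (P z))))
    (h2 : Integrable fun z : σ → ℝ =>
      fderiv ℝ G (P z) (fun x => ∑ y, (∑ j, ∑ k, P (Pi.single j 1) x * Mz⁻¹ j k * P (Pi.single k 1) y) * f y)
        * exp (-((1 / 2 : ℝ) * H (P z) (P z))))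
    (h3 : Integrable fun z : σ → ℝ => G (P z) * exp (-((1 / 2 : ℝ) * H (P z) (P z)))) :
    ∫ z : σ → ℝ, (∑ x, f x * P z x) * G (P z) * exp (-((1 / 2 : ℝ) * H (P z) (P z)))
      = ∫ z : σ → ℝ, fderiv ℝ G (P z) (fun x => ∑ y, (∑ j, ∑ k, P (Pi.single j 1) x * Mz⁻¹ j k * P (Pi.single k 1) y) * f y)
          * exp (-((1 / 2 : ℝ) * H (P z) (P z))) := by
  have hpd := chart_posDef P hHsym hfl hm hP hp Mz hMz
  have hGP : ∀ z : σ → ℝ, DifferentiableAt ℝ (G ∘ P) z := fun z => (hG (P z)).comp z P.differentiableAt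
  -- the three functions, read through the chart
  have hρ : ∀ z : σ → ℝ, exp (-(1 / 2 : ℝ) * (z ⬝ᵥ Mz *ᵥ z)) = exp (-((1 / 2 : ℝ) * H (P z) (P z))) := fun z => by
    rw [form_chart_eq P Mz hMz, neg_mul]
  have eL : (fun z : σ → ℝ =>
      (z ⬝ᵥ fun k => ∑ y, P (Pi.single k 1) y * f y) * (G ∘ P) z * exp (-(1 / 2 : ℝ) * (z ⬝ᵥ Mz *ᵥ z)))
      = fun z => (∑ x, f x * P z x) * G (P z) * exp (-((1 / 2 : ℝ) * H (P z) (P z))) := by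
    funext z
    rw [← pairing_eq_dotProduct P f z, hρ z]
    rfl
  have eR : (fun z : σ → ℝ =>
      fderiv ℝ (G ∘ P) z (Mz⁻¹ *ᵥ fun k => ∑ y, P (Pi.single k 1) y * f y) * exp (-(1 / 2 : ℝ) * (z ⬝ᵥ Mz *ᵥ z)))
      = fun z => fderiv ℝ G (P z) (fun x => ∑ y, (∑ j, ∑ k, P (Pi.single j 1) x * Mz⁻¹ j k * P (Pi.single k 1) y) * f y)
          * exp (-((1 / 2 : ℝ) * H (P z) (P z))) := by
    funext z
    rw [fderiv_comp_chart P z (hG _), covariance_mem_fibre P Mz f, hρ z]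
  have e3 : (fun z : σ → ℝ => (G ∘ P) z * exp (-(1 / 2 : ℝ) * (z ⬝ᵥ Mz *ᵥ z)))
      = fun z => G (P z) * exp (-((1 / 2 : ℝ) * H (P z) (P z))) := by
    funext z
    rw [hρ z]
    rfl
  have key := integral_dotProduct_mul_mul_gaussDensity_of_integrable Mz hpd hGP (fun k => ∑ y, P (Pi.single k 1) y * f y)
    (by rw [eL]; exact h1) (by rw [eR]; exact h2) (by rw [e3]; exact h3)
  rw [eL, eR] at key
  exact key

/-! ## §2. The tilted measure -/

omit [Fintype ι] in
/-- **THE PRODUCT RULE FOR `G·e^{−W}`**: `G, W` differentiable at `φ` ⟹ `D(G·e^{−W})(φ)v = (DG(φ)v − G(φ)·DW(φ)v)·e^{−W(φ)}`. [folklore] -/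
theorem fderiv_mul_exp_neg_apply [Fintype ι] {G W : (ι → ℝ) → ℝ} (φ : ι → ℝ) (hG : DifferentiableAt ℝ G φ)
    (hW : DifferentiableAt ℝ W φ) (v : ι → ℝ) :
    fderiv ℝ (fun ψ => G ψ * exp (-W ψ)) φ v = (fderiv ℝ G φ v - G φ * fderiv ℝ W φ v) * exp (-W φ) := by
  have h2 : HasFDerivAt (fun ψ => exp (-W ψ)) (exp (-W φ) • -fderiv ℝ W φ) φ := hW.hasFDerivAt.neg.exp
  have h := (hG.hasFDerivAt.mul h2).fderiv
  rw [show (fun ψ => G ψ * exp (-W ψ)) = G * fun ψ => exp (-W ψ) from rfl, h]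
  simp only [_root_.add_apply, _root_.smul_apply, _root_.neg_apply, smul_eq_mul]
  ring

/-- **HEADLINE — THE TILTED GAUSSIAN IBP ON THE FIBRE** (Glimm–Jaffe (9.1.32) for the fluctuation measure): `H` symmetric with floor,
chart bound, `M_z(j,k) = H(Pe_j)(Pe_k)`, `G, W` differentiable everywhere, and the three tilted products integrable ⟹
`∫ ⟨f,Pz⟩G(Pz)e^{−W(Pz)}ρ dz = ∫ (DG(Pz)(Cf) − G(Pz)·DW(Pz)(Cf))e^{−W(Pz)}ρ dz`, `ρ = e^{−½H(Pz)(Pz)}`, `Cf = PM_z⁻¹Pᵀf`. [folklore] -/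
theorem fibre_gaussian_ibp_tilted (hHsym : ∀ h k : ι → ℝ, H h k = H k h)
    (hfl : ∀ h : ι → ℝ, m * ∑ x, h x ^ 2 ≤ H h h) (hm : 0 < m) (hP : ∀ z : σ → ℝ, p * ∑ i, z i ^ 2 ≤ ∑ x, P z x ^ 2) (hp : 0 < p)
    (Mz : Matrix σ σ ℝ) (hMz : ∀ j k, Mz j k = H (P (Pi.single j 1)) (P (Pi.single k 1))) {G W : (ι → ℝ) → ℝ}
    (hG : ∀ v, DifferentiableAt ℝ G v) (hW : ∀ v, DifferentiableAt ℝ W v) (f : ι → ℝ)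
    (h1 : Integrable fun z : σ → ℝ => (∑ x, f x * P z x) * (G (P z) * exp (-W (P z))) * exp (-((1 / 2 : ℝ) * H (P z) (P z))))
    (h2 : Integrable fun z : σ → ℝ =>
      (fderiv ℝ G (P z) (fun x => ∑ y, (∑ j, ∑ k, P (Pi.single j 1) x * Mz⁻¹ j k * P (Pi.single k 1) y) * f y)
          - G (P z) * fderiv ℝ W (P z) (fun x => ∑ y, (∑ j, ∑ k, P (Pi.single j 1) x * Mz⁻¹ j k * P (Pi.single k 1) y) * f y))
        * exp (-W (P z)) * exp (-((1 / 2 : ℝ) * H (P z) (P z))))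
    (h3 : Integrable fun z : σ → ℝ => G (P z) * exp (-W (P z)) * exp (-((1 / 2 : ℝ) * H (P z) (P z)))) :
    ∫ z : σ → ℝ, (∑ x, f x * P z x) * (G (P z) * exp (-W (P z))) * exp (-((1 / 2 : ℝ) * H (P z) (P z)))
      = ∫ z : σ → ℝ,
          (fderiv ℝ G (P z) (fun x => ∑ y, (∑ j, ∑ k, P (Pi.single j 1) x * Mz⁻¹ j k * P (Pi.single k 1) y) * f y)
            - G (P z) * fderiv ℝ W (P z) (fun x => ∑ y, (∑ j, ∑ k, P (Pi.single j 1) x * Mz⁻¹ j k * P (Pi.single k 1) y) * f y))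
          * exp (-W (P z)) * exp (-((1 / 2 : ℝ) * H (P z) (P z))) := by
  have hGW : ∀ v, DifferentiableAt ℝ (fun ψ => G ψ * exp (-W ψ)) v := fun v => (hG v).mul (hW v).neg.exp
  have hD : ∀ z : σ → ℝ, fderiv ℝ (fun ψ => G ψ * exp (-W ψ)) (P z)
      (fun x => ∑ y, (∑ j, ∑ k, P (Pi.single j 1) x * Mz⁻¹ j k * P (Pi.single k 1) y) * f y)
      = (fderiv ℝ G (P z) (fun x => ∑ y, (∑ j, ∑ k, P (Pi.single j 1) x * Mz⁻¹ j k * P (Pi.single k 1) y) * f y)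
          - G (P z) * fderiv ℝ W (P z) (fun x => ∑ y, (∑ j, ∑ k, P (Pi.single j 1) x * Mz⁻¹ j k * P (Pi.single k 1) y) * f y))
        * exp (-W (P z)) := fun z => fderiv_mul_exp_neg_apply (P z) (hG _) (hW _) _
  have h := fibre_gaussian_ibp_of_integrable P hHsym hfl hm hP hp Mz hMz (G := fun ψ => G ψ * exp (-W ψ)) hGW f h1
    (by simp_rw [hD]; exact h2) h3
  simp_rw [hD] at h
  exact h

/-! ## §3. Toy -/

/-- Toy: with `W = 0` the tilted product rule is the plain derivative (`e^{0} = 1`, `DW = 0`). -/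
example {G : (Fin 1 → ℝ) → ℝ} (φ v : Fin 1 → ℝ) (hG : DifferentiableAt ℝ G φ) :
    fderiv ℝ (fun ψ => G ψ * exp (-(fun _ : Fin 1 → ℝ => (0 : ℝ)) ψ)) φ v = fderiv ℝ G φ v := by
  rw [fderiv_mul_exp_neg_apply φ hG (differentiableAt_const _) v]
  simp

end Summit.QuantumFields.BalabanUV.T4Continuum.NE7b.SupFibreGaussianIBPTilted
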